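import Mathlib.NumberTheory.ArithmeticFunction.Misc
import Mathlib.NumberTheory.Padics.PadicVal.Basic
import Mathlib.Analysis.SpecialFunctions.Log.Basic
import Mathlib.NumberTheory.Multiplicity
import Mathlib.FieldTheory.Finite.Basic
import HarnessLib

/-!
# Stewart's bound for the `p`-adic order of `aⁿ − bⁿ` (Stewart 2013, Theorem 2)

Topic `NumberTheory/DiophantineGeometry`; namespace `Literature.NumberTheory.DiophantineGeometry.Dioph`
(next to `MultiplicativeGroupApproximation.lean`, the Evertse–Győry / Yu `p`-adic approximation
facts it refines in the `p`-aspect).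

C. L. Stewart, *On divisors of Lucas and Lehmer numbers*, Acta Math. 211 (2013) 291–314 =
arXiv:1008.1274, Theorem 2 (arXiv p. 4), verbatim:

> **Theorem 2.** Let `a` and `b` be integers with `a > b > 0`. There exists a number `C₁`, which is
> effectively computable in terms of `ω(ab)`, such that if `p` is a prime number which does not
> divide `ab` and which exceeds `C₁` and `n` is an integer with `n ≥ 2` then
> `ord_p(aⁿ − bⁿ) < p exp(−log p / 52 log log p) log a + ord_p n`.                         (9′)

and (arXiv p. 5): "If `a` and `b` are integers with `a > b > 0`, `p` is an odd prime number which
does not divide `ab` and `n ≥ 2` then, as in the proof of Theorem 2,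
`ord_p(aⁿ − bⁿ) ≤ ord_p(a^{p−1} − b^{p−1}) + ord_p n`. In particular if `p` exceeds `C₁` then
`ord_p(a^{p−1} − b^{p−1}) < p exp(−log p / 52 log log p) log a`." (display (9)). Here `ω(m)` is
the number of distinct prime factors of `m` and `ord_p` the `p`-adic order. The proof (§6, arXiv
p. 13) is Lemma 8 of the paper (Yu's 2013 estimate for linear forms in `p`-adic logarithms with
the number of logarithms artificially inflated by auxiliary small primes) at `n = p − 1`, plus the
elementary (66) `ord_p(aⁿ − bⁿ) ≤ ord_p(a^{p−1} − b^{p−1}) + ord_p n`.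

## Contents

* `stewart2013_thm2` (**named fact**): Theorem 2 as printed, with `C₁ : ℕ → ℝ` a function of
  `ω(ab)` alone (the printed "effectively computable in terms of `ω(ab)`"; effectivity itself is
  not expressible and is dropped), `a b : ℕ` with `0 < b < a`, the order taken in `ℤ`
  (`padicValInt p (aⁿ − bⁿ)`, no truncated subtraction), `ω = ArithmeticFunction.cardDistinctFactors`,
  and the bound `p · exp(−log p / (52 · log log p)) · log a + ord_p n` read with the usual
  precedence `exp(−log p / (52 log log p))` (as the abstract's `exp(log n / (104 log log n))`).
* `stewart2013_thm2.wieferichOrder` (**proved** from the fact): display (9), the bound for the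
  Wieferich level `ord_p(a^{p−1} − b^{p−1}) < p exp(−log p/(52 log log p)) log a` for `p ∤ ab`,
  `p > C₁'(ω(ab))` — take `n = p − 1` (`≥ 2` once `p ≥ 3`, absorbed into `C₁' = max(C₁, 2)`) and
  `ord_p(p − 1) = 0`. This is the "unconditional record for Wieferich levels" quoted by route
  `ABC/LogCardinality` (items `PadicPowerSaving`, `WieferichShadow`).
* §6 of the paper, **proved**: the elementary inequality (66)
  (`padicValNat_pow_sub_pow_le_fermat`, `padicValInt_pow_sub_pow_le_fermat`), the equivalence of
  Theorem 2 with display (9) (`stewart2013_thm2_of_wieferichOrder`,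
  `stewart2013_thm2_iff_wieferichOrder`), and the reduction of Theorem 2 to the integer case of
  Lemma 8 (`stewart2013_thm2_of_lemma8Int`, deep input in the binder). The companion file
  `StewartPadicOrderLemma8Proofs.lean` continues with the printed proof of Lemma 8 (integer
  case) from Lemma 5 (= Yu 2013), again with the deep input in the binder.

## Rendering notes

* For `p` with `log log p ≤ 0` (`p = 2`) the real expression is junk-free but meaningless; the
  statement only concerns `p > C₁(ω(ab))` and `C₁` is existential (Stewart's `C₁` is large), so
  no vacuity arises. `Real.log`/`Real.exp` throughout; `(p : ℝ)` casts.
* `a > b > 0` are "integers" in print; positive integers are rendered as naturals `0 < b < a`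
  (then `aⁿ − bⁿ ≥ 1`, and `log a > 0` unless `a = 1`, excluded by `b ≥ 1`).
* Not vendored: Theorem 1 (`P(Φₙ(α,β)) > n exp(log n / 104 log log n)`, Lucas/Lehmer numbers)
  and Lemma 8 / Lemma 5 as named facts (they appear only as hypotheses in binders, here and in
  `StewartPadicOrderLemma8Proofs.lean`). Yamada's `C₂ (p/(log p)²) log a` bound (10) for `b = 1`
  is likewise only mentioned.

## References

* [Stewart2013] C. L. Stewart, *On divisors of Lucas and Lehmer numbers*, Acta Math. 211 (2013)
  291–314, doi:10.1007/s11511-013-0105-y = arXiv:1008.1274 — Theorem 2 (arXiv p. 4), displays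
  (9)–(10) (p. 5), §6 proof of Theorem 2 (p. 13).
* [Yu2013] K. Yu, *`p`-adic logarithmic forms and a problem of Erdős*, Acta Math. 211 (2013)
  315–382 (the estimate behind Lemma 8).
-/

noncomputable section

namespace Literature.NumberTheory.DiophantineGeometry.Dioph

/-- **Stewart 2013, Theorem 2** (Acta Math. 211, arXiv:1008.1274 p. 4). There is `C₁`, depending
only on `ω(ab)` (in print: "effectively computable in terms of `ω(ab)`"), such that for all
integers `a > b > 0`, every prime `p` with `p ∤ ab` and `p > C₁(ω(ab))`, and every integer
`n ≥ 2`,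
`ord_p(aⁿ − bⁿ) < p · exp(−log p / (52 log log p)) · log a + ord_p n`.
Rendering: `C₁ : ℕ → ℝ` applied to `ω(ab) = ArithmeticFunction.cardDistinctFactors (a * b)`;
`ord_p(aⁿ − bⁿ) = padicValInt p (aⁿ − bⁿ)` computed in `ℤ`; `ord_p n = padicValNat p n`. A named
fact (proof in print: Lemma 8 = Yu 2013 with inflated auxiliary primes, at `n = p − 1`, and the
elementary `ord_p(aⁿ − bⁿ) ≤ ord_p(a^{p−1} − b^{p−1}) + ord_p n`). [cite: Stewart2013, Theorem 2 (arXiv p. 4)] -/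
def stewart2013_thm2 : Prop :=
  ∃ C₁ : ℕ → ℝ, ∀ a b : ℕ, 0 < b → b < a → ∀ p : ℕ, p.Prime → ¬ p ∣ a * b →
    C₁ (ArithmeticFunction.cardDistinctFactors (a * b)) < p → ∀ n : ℕ, 2 ≤ n →
      (padicValInt p ((a : ℤ) ^ n - (b : ℤ) ^ n) : ℝ) <
        (p : ℝ) * Real.exp (-Real.log p / (52 * Real.log (Real.log p))) * Real.log a +
          padicValNat p n

/-- **Stewart 2013, display (9)** (arXiv p. 5: "In particular if `p` exceeds `C₁` then
`ord_p(a^{p−1} − b^{p−1}) < p exp(−log p / 52 log log p) log a`"), the unconditional record bound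
for Wieferich levels, *proved* from `stewart2013_thm2`: there is `C₁'` depending only on `ω(ab)`
such that for all integers `a > b > 0` and primes `p ∤ ab` with `p > C₁'(ω(ab))`,
`ord_p(a^{p−1} − b^{p−1}) < p · exp(−log p / (52 log log p)) · log a`.
Proof: Theorem 2 at `n = p − 1` (admissible since `C₁' = max(C₁, 2)` forces `p ≥ 3`) and
`ord_p(p − 1) = 0`. The exponent `p − 1` is a natural-number subtraction with `p ≥ 3`. [cite: Stewart2013, (9) (arXiv p. 5)] -/
theorem stewart2013_thm2.wieferichOrder (h : stewart2013_thm2) :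
    ∃ C₁ : ℕ → ℝ, ∀ a b : ℕ, 0 < b → b < a → ∀ p : ℕ, p.Prime → ¬ p ∣ a * b →
      C₁ (ArithmeticFunction.cardDistinctFactors (a * b)) < p →
        (padicValInt p ((a : ℤ) ^ (p - 1) - (b : ℤ) ^ (p - 1)) : ℝ) <
          (p : ℝ) * Real.exp (-Real.log p / (52 * Real.log (Real.log p))) * Real.log a := by
  obtain ⟨C₁, hC⟩ := h
  refine ⟨fun k => max (C₁ k) 2, fun a b hb hab p hp hpab hpC => ?_⟩
  have hC₁ : C₁ (ArithmeticFunction.cardDistinctFactors (a * b)) < p :=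
    lt_of_le_of_lt (le_max_left _ _) hpC
  have hp2 : (2 : ℝ) < p := lt_of_le_of_lt (le_max_right _ _) hpC
  have hp3 : 3 ≤ p := by exact_mod_cast hp2
  have hn : 2 ≤ p - 1 := by omega
  have key := hC a b hb hab p hp hpab hC₁ (p - 1) hn
  have h0 : padicValNat p (p - 1) = 0 := by
    refine padicValNat.eq_zero_of_not_dvd fun hd => ?_
    have : p ≤ p - 1 := Nat.le_of_dvd (by omega) hd
    omega
  simpa [h0] using key


/-! ### §6 of the paper: the elementary inequality (66) and the reduction of Theorem 2

The printed proof of Theorem 2 (arXiv p. 13) is: reduce to `gcd(a, b) = 1`, establish the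
elementary inequality

  (66) `ord_p(aⁿ − bⁿ) ≤ ord_p(a^{p−1} − b^{p−1}) + ord_p n`   (`p` odd, `p ∤ ab`, `n ≥ 1`),

"and our result now follows from (66) on taking `n = p − 1` in Lemma 8". Below, (66) is PROVED
(`padicValNat_pow_sub_pow_le_fermat`, `padicValInt_pow_sub_pow_le_fermat`; we deviate from the
printed order-of-apparition argument (62)–(65) by the shorter road through Mathlib's
lifting-the-exponent lemma `padicValNat.pow_sub_pow` applied to `x = a^{p−1}`, `y = b^{p−1}`,
using `aⁿ − bⁿ ∣ xⁿ − yⁿ`), and the two reductions of §6 are PROVED as implications with their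
deep input spelled out in the binder (no named fact is introduced):

* `stewart2013_thm2_of_wieferichOrder`: Theorem 2 follows from its case `n = p − 1`, display (9)
  (converse of `stewart2013_thm2.wieferichOrder`; hence `stewart2013_thm2_iff_wieferichOrder`);
* `stewart2013_thm2_of_lemma8Int`: Theorem 2 follows from the integer case of **Lemma 8**
  (arXiv p. 9: for `n > 1`, `p ∤ αβ`, `p > C(ω(αβ), disc ℚ(α/β))`,
  `ord_℘((α/β)ⁿ − 1) < p exp(−log p / 51.9 log log p) log|α| log n`; for `α = a > β = b > 0`
  integers `ℚ(α/β) = ℚ`, `℘ = p` and `ord_p((a/b)ⁿ − 1) = ord_p(aⁿ − bⁿ)` as `p ∤ b`), via (66)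
  at `n = p − 1` and the absorption `exp(−log p/(51.9 log log p)) · log p ≤ exp(−log p/(52 log log p))`
  for `p > c₇` (`exp_mul_log_le_exp_eventually`; the printed "for `p > c₇`", here from
  `(log L)² = o(L)`).

Lemma 8 itself is Lemma 5 of the paper (= the Main Theorem of K. Yu, *p-adic logarithmic forms
and a problem of Erdős*, Acta Math. 211 (2013) [SY2]) with `k = [log p / 51.8 log log p]`
logarithms inflated by auxiliary primes, plus the prime number theorem; Yu's theory is not
available in Lean, so `stewart2013_thm2` stays a named fact whose remaining debt is exactly the
integer case of Lemma 8. -/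

/-- **Fermat quotient divisibility, two variables, in `ℕ`**: for a prime `p` with `p ∤ a`,
`p ∤ b` and `b ≤ a`, `p ∣ a^{p−1} − b^{p−1}` (truncated subtraction, harmless as
`b^{p−1} ≤ a^{p−1}`). [folklore] -/
theorem prime_dvd_pow_sub_pow_fermat {p a b : ℕ} (hp : p.Prime) (ha : ¬ p ∣ a) (hb : ¬ p ∣ b)
    (hba : b ≤ a) : p ∣ a ^ (p - 1) - b ^ (p - 1) := by
  have ha' : a ^ (p - 1) ≡ 1 [MOD p] := by
    simpa [Nat.totient_prime hp] using Nat.ModEq.pow_totient (hp.coprime_iff_not_dvd.mpr ha).symm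
  have hb' : b ^ (p - 1) ≡ 1 [MOD p] := by
    simpa [Nat.totient_prime hp] using Nat.ModEq.pow_totient (hp.coprime_iff_not_dvd.mpr hb).symm
  exact (Nat.modEq_iff_dvd' (Nat.pow_le_pow_left hba _)).mp (hb'.trans ha'.symm)

/-- **[Stewart2013, (66)] in `ℕ`.** For an odd prime `p`, naturals `b < a` with `p ∤ a`, `p ∤ b`,
and every `n`, `ord_p(aⁿ − bⁿ) ≤ ord_p(a^{p−1} − b^{p−1}) + ord_p n`.
Proof: with `x = a^{p−1}`, `y = b^{p−1}` one has `p ∣ x − y`, `p ∤ x`, so by the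
lifting-the-exponent lemma `ord_p(xⁿ − yⁿ) = ord_p(x − y) + ord_p n`, and `aⁿ − bⁿ ∣ xⁿ − yⁿ`
(as `xⁿ = (aⁿ)^{p−1}`). The paper argues instead through the rank of apparition `ℓ(p)` and
(62)–(65); the inequality obtained is the same. [cite: Stewart2013, (66) (arXiv p. 13)] -/
theorem padicValNat_pow_sub_pow_le_fermat {p a b : ℕ} (hp : p.Prime) (hp2 : p ≠ 2)
    (ha : ¬ p ∣ a) (hb : ¬ p ∣ b) (hba : b < a) (n : ℕ) :
    padicValNat p (a ^ n - b ^ n) ≤ padicValNat p (a ^ (p - 1) - b ^ (p - 1)) + padicValNat p n := by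
  rcases Nat.eq_zero_or_pos n with rfl | hn
  · simp
  haveI := Fact.mk hp
  have hp1 : Odd p := hp.odd_of_ne_two hp2
  have hp0 : p - 1 ≠ 0 := by have := hp.two_le; omega
  set x := a ^ (p - 1) with hx_def
  set y := b ^ (p - 1) with hy_def
  have hyx : y < x := Nat.pow_lt_pow_left hba hp0
  have hx : ¬ p ∣ x := fun h => ha (hp.dvd_of_dvd_pow h)
  have hxy : p ∣ x - y := prime_dvd_pow_sub_pow_fermat hp ha hb hba.le
  have key : padicValNat p (x ^ n - y ^ n) = padicValNat p (x - y) + padicValNat p n :=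
    padicValNat.pow_sub_pow hp1 hyx hxy hx hn.ne'
  have hdvd : a ^ n - b ^ n ∣ x ^ n - y ^ n := by
    have hx' : x ^ n = (a ^ n) ^ (p - 1) := by rw [hx_def, ← pow_mul, ← pow_mul, mul_comm]
    have hy' : y ^ n = (b ^ n) ^ (p - 1) := by rw [hy_def, ← pow_mul, ← pow_mul, mul_comm]
    rw [hx', hy']
    exact Nat.sub_dvd_pow_sub_pow _ _ _
  have hne : x ^ n - y ^ n ≠ 0 := Nat.sub_ne_zero_of_lt (Nat.pow_lt_pow_left hyx hn.ne')
  have hle : padicValNat p (a ^ n - b ^ n) ≤ padicValNat p (x ^ n - y ^ n) :=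
    (padicValNat_dvd_iff_le hne).mp (dvd_trans pow_padicValNat_dvd hdvd)
  omega

/-- For naturals `b ≤ a` the `p`-adic order of the integer `aⁿ − bⁿ` is that of the natural
number `aⁿ − bⁿ`. [folklore] -/
theorem padicValInt_natCast_pow_sub_pow {a b : ℕ} (p n : ℕ) (hba : b ≤ a) :
    padicValInt p ((a : ℤ) ^ n - (b : ℤ) ^ n) = padicValNat p (a ^ n - b ^ n) := by
  have h : ((a : ℤ) ^ n - (b : ℤ) ^ n) = ((a ^ n - b ^ n : ℕ) : ℤ) := by
    rw [Nat.cast_sub (Nat.pow_le_pow_left hba n)]; push_cast; ring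
  rw [h, padicValInt.of_nat]

/-- **[Stewart2013, (66)]** as used for Theorem 2 (orders in `ℤ`): for an odd prime `p`,
naturals `b < a` with `p ∤ a`, `p ∤ b`, and every `n`,
`ord_p(aⁿ − bⁿ) ≤ ord_p(a^{p−1} − b^{p−1}) + ord_p n`. [cite: Stewart2013, (66) (arXiv p. 13)] -/
theorem padicValInt_pow_sub_pow_le_fermat {p a b : ℕ} (hp : p.Prime) (hp2 : p ≠ 2)
    (ha : ¬ p ∣ a) (hb : ¬ p ∣ b) (hba : b < a) (n : ℕ) :
    padicValInt p ((a : ℤ) ^ n - (b : ℤ) ^ n) ≤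
      padicValInt p ((a : ℤ) ^ (p - 1) - (b : ℤ) ^ (p - 1)) + padicValNat p n := by
  rw [padicValInt_natCast_pow_sub_pow p n hba.le, padicValInt_natCast_pow_sub_pow p (p - 1) hba.le]
  exact padicValNat_pow_sub_pow_le_fermat hp hp2 ha hb hba n

/-- **Theorem 2 from display (9)** ([Stewart2013], §6, arXiv p. 13: "our result now follows from
(66) on taking `n = p − 1`"): if there is `C₁'` depending only on `ω(ab)` with
`ord_p(a^{p−1} − b^{p−1}) < p exp(−log p/(52 log log p)) log a` for all `a > b > 0`, primes
`p ∤ ab`, `p > C₁'(ω(ab))`, then Theorem 2 holds (with `C₁ = max(C₁', 2)`, which makes `p` odd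
so that (66) applies). Converse of `stewart2013_thm2.wieferichOrder`. [cite: Stewart2013, §6 (arXiv p. 13)] -/
theorem stewart2013_thm2_of_wieferichOrder
    (h : ∃ C₁ : ℕ → ℝ, ∀ a b : ℕ, 0 < b → b < a → ∀ p : ℕ, p.Prime → ¬ p ∣ a * b →
      C₁ (ArithmeticFunction.cardDistinctFactors (a * b)) < p →
        (padicValInt p ((a : ℤ) ^ (p - 1) - (b : ℤ) ^ (p - 1)) : ℝ) <
          (p : ℝ) * Real.exp (-Real.log p / (52 * Real.log (Real.log p))) * Real.log a) :
    stewart2013_thm2 := by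
  obtain ⟨C₁, hC⟩ := h
  refine ⟨fun k => max (C₁ k) 2, fun a b hb hab p hp hpab hpC n _hn => ?_⟩
  have hC₁ : C₁ (ArithmeticFunction.cardDistinctFactors (a * b)) < p :=
    lt_of_le_of_lt (le_max_left _ _) hpC
  have hp2 : (2 : ℝ) < p := lt_of_le_of_lt (le_max_right _ _) hpC
  have hp2' : p ≠ 2 := by
    rintro rfl
    norm_num at hp2
  have ha : ¬ p ∣ a := fun h => hpab (dvd_mul_of_dvd_left h b)
  have hb' : ¬ p ∣ b := fun h => hpab (dvd_mul_of_dvd_right h a)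
  have key := hC a b hb hab p hp hpab hC₁
  have h66 : (padicValInt p ((a : ℤ) ^ n - (b : ℤ) ^ n) : ℝ) ≤
      (padicValInt p ((a : ℤ) ^ (p - 1) - (b : ℤ) ^ (p - 1)) : ℝ) + (padicValNat p n : ℝ) := by
    exact_mod_cast padicValInt_pow_sub_pow_le_fermat hp hp2' ha hb' hab n
  linarith

/-- **Theorem 2 ⟺ display (9)**: Stewart's Theorem 2 is equivalent to its Wieferich-level case
`n = p − 1` (both with thresholds depending only on `ω(ab)`), by (66) in one direction and
`ord_p(p − 1) = 0` in the other. [cite: Stewart2013, §6 (arXiv p. 13)] -/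
theorem stewart2013_thm2_iff_wieferichOrder :
    stewart2013_thm2 ↔
      ∃ C₁ : ℕ → ℝ, ∀ a b : ℕ, 0 < b → b < a → ∀ p : ℕ, p.Prime → ¬ p ∣ a * b →
        C₁ (ArithmeticFunction.cardDistinctFactors (a * b)) < p →
          (padicValInt p ((a : ℤ) ^ (p - 1) - (b : ℤ) ^ (p - 1)) : ℝ) <
            (p : ℝ) * Real.exp (-Real.log p / (52 * Real.log (Real.log p))) * Real.log a :=
  ⟨stewart2013_thm2.wieferichOrder, stewart2013_thm2_of_wieferichOrder⟩

/-- `26988 (log L)² ≤ L` for all large `L` (from `(log L)² = o(L)`); `1/26988 = 1/51.9 − 1/52` is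
the room between the exponents of Lemma 8 and Theorem 2. [folklore] -/
theorem eventually_mul_log_sq_le : ∃ L₀ : ℝ, ∀ L : ℝ, L₀ ≤ L → 26988 * Real.log L ^ 2 ≤ L := by
  have h := (Real.isLittleO_pow_log_id_atTop (n := 2)).def (show (0 : ℝ) < 1 / 26988 by norm_num)
  obtain ⟨L₀, hL₀⟩ := Filter.eventually_atTop.mp h
  refine ⟨max L₀ 0, fun L hL => ?_⟩
  have h1 := hL₀ L (le_trans (le_max_left _ _) hL)
  have hL0 : 0 ≤ L := le_trans (le_max_right _ _) hL
  rw [Real.norm_eq_abs, Real.norm_eq_abs, abs_of_nonneg (sq_nonneg _), id, abs_of_nonneg hL0] at h1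
  linarith

/-- **The absorption "for `p > c₇`"** in the proof of Lemma 8 / Theorem 2: for all large real `x`,
`exp(−log x / (51.9 log log x)) · log x ≤ exp(−log x / (52 log log x))`. Indeed with
`L = log x`, `ℓ = log L > 0` this reads `ℓ − L/(51.9 ℓ) ≤ −L/(52 ℓ)`, i.e. `26988 ℓ² ≤ L`
(a calculus fact: the room between the exponents `51.9` of Lemma 8 and `52` of Theorem 2). [folklore] -/
theorem exp_mul_log_le_exp_eventually : ∃ x₀ : ℝ, ∀ x : ℝ, x₀ ≤ x →
    Real.exp (-Real.log x / (51.9 * Real.log (Real.log x))) * Real.log x ≤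
      Real.exp (-Real.log x / (52 * Real.log (Real.log x))) := by
  obtain ⟨L₀, hL₀⟩ := eventually_mul_log_sq_le
  refine ⟨Real.exp (max L₀ (Real.exp 1)), fun x hx => ?_⟩
  have hx0 : 0 < x := lt_of_lt_of_le (Real.exp_pos _) hx
  have hL : max L₀ (Real.exp 1) ≤ Real.log x := by
    rw [← Real.log_exp (max L₀ (Real.exp 1))]
    exact Real.log_le_log (Real.exp_pos _) hx
  set L := Real.log x with hL_def
  have hLe : Real.exp 1 ≤ L := le_trans (le_max_right _ _) hL
  have hLpos : 0 < L := lt_of_lt_of_le (Real.exp_pos 1) hLe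
  have hℓ : 1 ≤ Real.log L := by
    rw [← Real.log_exp 1]; exact Real.log_le_log (Real.exp_pos 1) hLe
  set ℓ := Real.log L with hℓ_def
  have hℓpos : 0 < ℓ := by linarith
  have hkey : 26988 * ℓ ^ 2 ≤ L := hL₀ L (le_trans (le_max_left _ _) hL)
  -- rewrite `log x = exp ℓ` and compare exponents
  have hLexp : L = Real.exp ℓ := by rw [hℓ_def, Real.exp_log hLpos]
  rw [show Real.exp (-L / (51.9 * ℓ)) * L = Real.exp (-L / (51.9 * ℓ) + ℓ) by
    rw [Real.exp_add, ← hLexp]]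
  rw [Real.exp_le_exp]
  rw [show -L / (51.9 * ℓ) + ℓ = (-L * 52 + 51.9 * 52 * ℓ ^ 2) / (51.9 * 52 * ℓ) by
    field_simp]
  rw [show -L / (52 * ℓ) = (-L * 51.9) / (51.9 * 52 * ℓ) by field_simp]
  rw [div_le_div_iff_of_pos_right (by positivity)]
  nlinarith

/-- **Theorem 2 from Lemma 8 (integer case)** — the last line of §6 of [Stewart2013] (arXiv
p. 13). The hypothesis `h8` is Lemma 8 of the paper (arXiv p. 9) for `α = a > β = b > 0`
rational integers: then `ℚ(α/β) = ℚ` (discriminant `1`, so the threshold depends on `ω(ab)`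
alone), `℘ = (p)`, `log|α| = log a`, and `ord_p((a/b)ⁿ − 1) = ord_p(aⁿ − bⁿ)` because `p ∤ b`:
for `n > 1` and primes `p ∤ ab` with `p > C(ω(ab))`,
`ord_p(aⁿ − bⁿ) < p · exp(−log p / (51.9 log log p)) · log a · log n`.
Proof: for `p > max(C, x₀, 2)`, (66) gives `ord_p(aⁿ − bⁿ) ≤ ord_p(a^{p−1} − b^{p−1}) + ord_p n`,
`h8` at `n = p − 1` bounds the first term by `p e^{−log p/(51.9 log log p)} log a · log(p − 1)`,
and `log(p − 1) ≤ log p` is absorbed: `e^{−log p/(51.9 log log p)} log p ≤ e^{−log p/(52 log log p)}`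
(`exp_mul_log_le_exp_eventually`). Lemma 8 is Yu's theorem [SY2] with inflated auxiliary
primes and is NOT proved here. [cite: Stewart2013, §6 (arXiv p. 13) and Lemma 8 (arXiv p. 9)] -/
theorem stewart2013_thm2_of_lemma8Int
    (h8 : ∃ C : ℕ → ℝ, ∀ a b : ℕ, 0 < b → b < a → ∀ p : ℕ, p.Prime → ¬ p ∣ a * b →
      C (ArithmeticFunction.cardDistinctFactors (a * b)) < p → ∀ n : ℕ, 1 < n →
        (padicValInt p ((a : ℤ) ^ n - (b : ℤ) ^ n) : ℝ) <
          (p : ℝ) * Real.exp (-Real.log p / (51.9 * Real.log (Real.log p))) * Real.log a *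
            Real.log n) :
    stewart2013_thm2 := by
  obtain ⟨C, hC⟩ := h8
  obtain ⟨x₀, hx₀⟩ := exp_mul_log_le_exp_eventually
  refine stewart2013_thm2_of_wieferichOrder ⟨fun k => max (C k) (max x₀ 2), ?_⟩
  intro a b hb hab p hp hpab hpC
  have hCp : C (ArithmeticFunction.cardDistinctFactors (a * b)) < p :=
    lt_of_le_of_lt (le_max_left _ _) hpC
  have hx₀p : x₀ ≤ (p : ℝ) := (le_trans (le_max_left _ _) (le_max_right _ _)).trans hpC.le
  have hp2 : (2 : ℝ) < p := lt_of_le_of_lt (le_trans (le_max_right _ _) (le_max_right _ _)) hpC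
  have hp3 : 3 ≤ p := by exact_mod_cast hp2
  have hn : 1 < p - 1 := by omega
  have key := hC a b hb hab p hp hpab hCp (p - 1) hn
  have habs := hx₀ p hx₀p
  have ha2 : (2 : ℝ) ≤ a := by exact_mod_cast (show 2 ≤ a by omega)
  have hloga : 0 ≤ Real.log a := Real.log_nonneg (by linarith)
  have hp0 : (0 : ℝ) < p := by linarith
  have hlogp1 : Real.log ((p - 1 : ℕ) : ℝ) ≤ Real.log p := by
    have h1 : ((p - 1 : ℕ) : ℝ) = (p : ℝ) - 1 := by
      rw [Nat.cast_sub (by omega)]; simp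
    rw [h1]
    exact Real.log_le_log (by linarith) (by linarith)
  have hlogp1_nonneg : 0 ≤ Real.log ((p - 1 : ℕ) : ℝ) :=
    Real.log_nonneg (by
      have h1 : ((p - 1 : ℕ) : ℝ) = (p : ℝ) - 1 := by rw [Nat.cast_sub (by omega)]; simp
      rw [h1]; linarith)
  set E₁ := Real.exp (-Real.log p / (51.9 * Real.log (Real.log p))) with hE₁
  set E₂ := Real.exp (-Real.log p / (52 * Real.log (Real.log p))) with hE₂
  have hE₁pos : 0 < E₁ := Real.exp_pos _
  -- `p E₁ log a log(p-1) ≤ p E₁ log a log p = p (E₁ log p) log a ≤ p E₂ log a`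
  calc (padicValInt p ((a : ℤ) ^ (p - 1) - (b : ℤ) ^ (p - 1)) : ℝ)
      < (p : ℝ) * E₁ * Real.log a * Real.log ((p - 1 : ℕ) : ℝ) := key
    _ ≤ (p : ℝ) * E₁ * Real.log a * Real.log p := by
        apply mul_le_mul_of_nonneg_left hlogp1
        positivity
    _ = (p : ℝ) * (E₁ * Real.log p) * Real.log a := by ring
    _ ≤ (p : ℝ) * E₂ * Real.log a := by
        apply mul_le_mul_of_nonneg_right _ hloga
        exact mul_le_mul_of_nonneg_left habs hp0.le

end Literature.NumberTheory.DiophantineGeometry.Dioph
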